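/-
Origin: expansion seat `prover-pub-hodgecm-mc-sinst-1-g11-0`, handover #1268 2026-08-21T03:47Z md5 e8f8389db4f9 (371 l.; NEW additive leaf, ns HodgeCM.Model.ThetaAdelicSide; SLOT 2 = the slot-0 text of #1266 on the conjugated plane's first line ⟨a₂⟩, a₂ = dW' c.D 0: § 0 NEW `def splitLineTwoG V c hGR₂ : SplitLine (diagonal (frameD V)) …` (JW := diagonal (lineVec (dW' c.D 0)), s := splittingOf hGR₂; #1254's `splitLineZero` text) and `def chiTwoG c χ : UfTwo c.D →* ℂˣ` (χ⁻¹ ∘ mk ∘ finLineTorusIdeles (dW' c.D 0) = D₂.chiFin χ by rfl); § 1 `cVTwoG ∕ cWTwoG ∕ psiTwoG η₂` (finCharTwo of #1257), chiTwoG_eq_mul_psiTwoG, ωfW_∕ωfV_twoG_finSBReindex, `def coinvEquivTwoG` (+_mk), coinvRep_coinvEquivTwoG (intertwining law), coinvEquivTwoG_twist_of_eq, `def ΩEquivTwoG`, iSup_range_coinvRep_twoG_eq, `def dictEquivTwoOfBigCharG`; § 2 `def adelicCharTwoG η₂ := η₂(·,1)·χ₂′(·,1)` (χ₂′ = cmConjLineChar₀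 … c.D.isoGL (isoGL_hg₀ c.D) hGR hGR₂ hGR₃) (+_apply), lineVec_dW'_zero_ne, `def bigCharTwoG := LinePair.bigCharOfV … (adelicCharTwoG η₂)`, twistCharV_bigCharTwoG_comp, cmConjLineChar₀_inl_eq_one_of_rat ([Weil1964, Thm 6] charV₃₄_eq_one_of_rational at ratIsometry_conj), adelicCharTwoG_eq_one_of_rat (hη₂V : ∀ v ∈ CMRat (frameD V), η₂ (v,1) = 1), bigCharTwoG_isRatTrivial, `def splitLineTwoTwistedG`, `def charTwoDictG χ := twistCharW ĉ₂(η₂) · psiTwoG η₂ χ`, `def dictEquivTwoCanonicalG : Ω(splitLineTwoG ⊗ ĉ₂(η₂), χ″₂) ≃ₗ[adelicAlgebra V] (D₂.coinvRep χ).asModule` (D₂ := thetaDistDatumTwoOfG V c S hGR hGR₀ hGR₁ hGR₂ hGR₃ η₀ η₁ η₂ η₃ hι h₁W hV hω hη₂c Φarch harm hdef) + _surjective + iSup_range_coinvRep_twoG_eq_dict; cert rc 0 ∕ 157 s, 0 warn ∕ 0 proof-hole; NAMES for audit: HodgeCM.Model.ThetaAdelicSide.coinvRep_coinvEquivTwoG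 · HodgeCM.Model.ThetaAdelicSide.bigCharTwoG_isRatTrivial · HodgeCM.Model.ThetaAdelicSide.dictEquivTwoCanonicalG_surjective) (`HOME/mc/pub-hodgecm-mc-sinst-1-g11/stage70/HodgeCM/Model/AdelicThetaSlotTwoBridgeG.lean`, md5 e8f8389db4f9, 371 lines);
landed by the gen-30 packager (p-g30) in gate run 71 as `HodgeCM/Model/AdelicThetaSlotTwoBridgeG.lean` (verbatim).
-/
/-
Copyright (c) 2026 the pub-hodgecm formalisation cell (harness21).  New file, not vendored.
Origin: session prover-pub-hodgecm-mc-sinst-1-g11-0 (unit pub-hodgecm-mc-sinst-1-g11, S-INSTANCE CONSTRUCTOR gen 11; the (J4)↔(J3) BRIDGE of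
SLOT 2 (the conjugated plane's first line) cut ONCE over the pin-agnostic G-datum (lead 1-g84 ROUTING WORD 2026-08-21T02:34:03Z): the slot-0
text of `Model/AdelicThetaSlotZeroBridgeG` with `dW' c.D 0`, `hGR₂`, `cmConjLineChar₀` and the slot character `η₂` GENERIC, side `S` arbitrary), 2026-08-21.
Intended final place: `HodgeCM/Model/AdelicThetaSlotTwoBridgeG.lean` (NEW additive model-layer leaf; imports sinst-1 #1262 `Model/AdelicThetaDistributionOfG`,
#1256 `Model/AdelicThetaDistributionBridgeTwist`; nothing imports it yet (the slot-2 automorphy sibling will); drop alone).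
-/
import Summits.HodgeConjecture.HodgeCM.Model.AdelicThetaDistributionOfG
import Summits.HodgeConjecture.HodgeCM.Model.AdelicThetaDistributionBridgeTwist

set_option autoImplicit false

/-!
# Slot 2 over the G-datum: the honest module `Ω₂(χ)` is a dictionary carrier at a twisted record, for ANY slot character `η₂` and ANY side

For any side `S` reading back to `lineRepOf … η₀ η₁ η₂ η₃` (`hω`, `hι`) and the G-datum `D₂ := thetaDistDatumTwoOfG … η₂ …` (#1262):
* § 0 NEW index record `splitLineTwoG` (`JW := diagonal (lineVec (dW' c.D 0))`, `s := splittingOf hGR₂`) and coinvariant character `chiTwoG χ`;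
* § 1 `cVTwoG ∕ cWTwoG ∕ psiTwoG`, `coinvEquivTwoG`, `coinvRep_coinvEquivTwoG`, **`ΩEquivTwoG`**, blocks equal (#1254 § 2b's text for the conjugated line);
* § 2 `adelicCharTwoG η₂ := η₂(·,1) · χ₂(·,1)`, `bigCharTwoG`, `twistCharV_bigCharTwoG_comp`, **`bigCharTwoG_isRatTrivial`** under
  `hη₂V : ∀ v ∈ CMRat (frameD V), η₂ (v, 1) = 1` (+ [Weil1964, Thm 6] for `λ_V′`, `cmConjLineChar₀_inl_eq_one_of_rat` from `ratIsometry_conj`), `splitLineTwoTwistedG`,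
  `dictEquivTwoOfBigCharG`, `charTwoDictG`, **`dictEquivTwoCanonicalG`** + `_surjective`, blocks equal (#1256 §§ 2–4's text for the conjugated line).
At the default split `η₂ := eta₂ V c.D η` (`thetaDistDatumTwoOfG_archSideOf`); at the R2 pin `η₂ := etaT₂ η ν'`.  KERNEL only: 0 records, 0 `def … : Prop`, nothing cited as a hypothesis; `#print axioms` ⊆ {propext, Classical.choice, Quot.sound}.
-/

noncomputable section

open MulAction IsDedekindDomain NumberField.mixedEmbedding
open NumberField hiding relNormOneIdeles relNormOneRat probHaarRelNormOneQuot relNormOneInfUnits relNormOneInfToIdeles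
open scoped Matrix TensorProduct Classical SchwartzMap
open Literature.NumberTheory.Automorphic Literature.NumberTheory.Weil1964
open Literature.NumberTheory.GelbartRogawski1991 Literature.NumberTheory.GelbartRogawski1991.UnitaryDualPair
open Literature.RepresentationTheory (SeesawScalar.twist SeesawScalar.twist_apply)
open Literature.Geometry.ComplexHyperbolic.BallModel (U21 x₀)
open Literature.AlgebraicGeometry.ShimuraVarieties
open HodgeCM.Adelic HodgeCM.PerL34 HodgeCM.Model.ArchSideTerm HodgeCM.Model.ThetaDistFin

namespace HodgeCM.Model
namespace ThetaAdelicSide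

variable {L : CMField} {ι₁ : L →+* ℂ} (V : HermSpace3 L ι₁) (c : SeesawCtx L) (S : ThetaAdelicSide V c)
  (hGR : (cmSplittingDatum (L : Type) finProdFinEquiv (frameD V) (frameD_real V) (frameD_ne V) (dW c.D) (dW_real c.D)
    (dW_ne c.D)).CompatibleSplitting)
  (hGR₀ : (cmSplittingDatum (L : Type) (e₁) (frameD V) (frameD_real V) (frameD_ne V) (lineVec (L : Type) (dW c.D 0))
    (fun _ => dW_real c.D 0) (fun _ => dW_ne c.D 0)).CompatibleSplitting)
  (hGR₁ : (cmSplittingDatum (L : Type) (e₁) (frameD V) (frameD_real V) (frameD_ne V) (lineVec (L : Type) (dW c.D 1))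
    (fun _ => dW_real c.D 1) (fun _ => dW_ne c.D 1)).CompatibleSplitting)
  (hGR₂ : (cmSplittingDatum (L : Type) (e₁) (frameD V) (frameD_real V) (frameD_ne V) (lineVec (L : Type) (dW' c.D 0))
    (fun _ => dW'_real c.D 0) (fun _ => dW'_ne c.D 0)).CompatibleSplitting)
  (hGR₃ : (cmSplittingDatum (L : Type) (e₁) (frameD V) (frameD_real V) (frameD_ne V) (lineVec (L : Type) (dW' c.D 1))
    (fun _ => dW'_real c.D 1) (fun _ => dW'_ne c.D 1)).CompatibleSplitting)
  (η₀ η₁ η₂ η₃ : CMAdelic (L : Type) (frameD V) × CMAdelicOne (L : Type) →* ℂˣ)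
  (hι : S.ιinf = archInfOf V)
  (h₁W : (∀ j, 0 < (ι₁ (dW c.D j)).re) ∨ ∀ j, (ι₁ (dW c.D j)).re < 0)
  (hV : IsAnisotropic L V.Hm)
  (hω : (S.P 2).ω = lineRepOf V c.D hGR hGR₀ hGR₁ hGR₂ hGR₃ η₀ η₁ η₂ η₃ 2)
  (hη₂c : Continuous fun p => ((η₂ p : ℂˣ) : ℂ))

/-! ## § 0. The index record and the coinvariant character of slot 2 (the conjugated plane's line `⟨a₂⟩`, `a₂ = dW' c.D 0`) -/

/-- **the dictionary index record of slot 2**: the framed hermitian line `⟨a₂⟩` (`a₂ = dW' c.D 0`, the conjugated plane) over `L`,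
enumeration `e₁`, with the CHOSEN compatible pair splitting `splittingOf hGR₂` of `U(diag frameD V) × U(⟨a₂⟩)` ([GelbartRogawski1991,
Prop. 3.1.1] as cited by `hGR₂`) — a `SplitLine` at the framed `V`-datum `JV := diagonal (frameD V)` (#1254 `splitLineZero` with `dW' c.D 0`). -/
def splitLineTwoG :
    SplitLine (Matrix.diagonal (frameD V)) (realDiagonal (L : Type) (frameD V) (frameD_real V))
      (complexConj_imagUnit (L : Type)) (imagUnit_ne_zero (L : Type)) (imagUnit_mul_self (L : Type))
      (realDiagonal_isSymm (L : Type) (frameD V) (frameD_real V))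
      (isUnit_det_realDiagonal (L : Type) (frameD V) (frameD_real V) (frameD_ne V))
      (realDiagonal_map (L : Type) (frameD V) (frameD_real V)).symm where
  n := 3
  e := e₁
  JW := Matrix.diagonal (lineVec (L : Type) (dW' c.D 0))
  TW := realDiagonal (L : Type) (lineVec (L : Type) (dW' c.D 0)) fun _ => dW'_real c.D 0
  hW := realDiagonal_isSymm (L : Type) (lineVec (L : Type) (dW' c.D 0)) fun _ => dW'_real c.D 0
  hWd := isUnit_det_realDiagonal (L : Type) (lineVec (L : Type) (dW' c.D 0)) (fun _ => dW'_real c.D 0) fun _ => dW'_ne c.D 0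
  hJW := (realDiagonal_map (L : Type) (lineVec (L : Type) (dW' c.D 0)) fun _ => dW'_real c.D 0).symm
  s := splittingOf _ _ _ _ _ _ _ _ _ _ _ _ _ _ _ _ _ hGR₂
  hs := splittingOf_isCompatible _ _ _ _ _ _ _ _ _ _ _ _ _ _ _ _ _ hGR₂

/-- **`χ ↦ chiTwoG χ : u ↦ χ(finLineTorusIdeles u)⁻¹`** — the coinvariant character of slot 2 (the `chiFin` of every slot-2 G-datum,
definitionally: `toIdele := finLineTorusIdeles (dW' c.D 0)`). -/
def chiTwoG (χ : PontryaginDual (↥(relNormOneIdeles (↥(maximalRealSubfield L)) L) ⧸ relNormOneRat (↥(maximalRealSubfield L)) L)) :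
    UfTwo c.D →* ℂˣ :=
  (Circle.toUnits : Circle →* ℂˣ).comp <| (invMonoidHom : Circle →* Circle).comp <|
    (χ : ↥(relNormOneIdeles (↥(maximalRealSubfield L)) L) ⧸ relNormOneRat (↥(maximalRealSubfield L)) L →* Circle).comp <|
      (QuotientGroup.mk' (relNormOneRat (↥(maximalRealSubfield L)) L)).comp
        (finLineTorusIdeles (L : Type) (dW' c.D 0) (dW'_ne c.D 0))

/-! ## § 1. The slot-2 characters at a generic `η₂` and the coinvariant comparison -/

/-- **`c_{V,2}(η₂) : k ↦ finCharTwo η₂ (k, 1)`** — the `U(V)(𝔸_f)`-part of the slot-2 see-saw character for the slot character `η₂`. -/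
def cVTwoG : ↥V.adelicFin →* ℂˣ :=
  (finCharTwo V c.D hGR hGR₂ hGR₃ η₂).comp (MonoidHom.inl _ _)

/-- **`c_{W,2}(η₂) : u ↦ finCharTwo η₂ (1, u)`**. -/
def cWTwoG : UfTwo c.D →* ℂˣ :=
  (finCharTwo V c.D hGR hGR₂ hGR₃ η₂).comp (MonoidHom.inr _ _)

/-- (Ported verbatim from the HodgeCMPerL package; no docstring in the source.) -/
@[simp] theorem cVTwoG_apply (g : ↥V.adelicFin) :
    cVTwoG V c hGR hGR₂ hGR₃ η₂ g = finCharTwo V c.D hGR hGR₂ hGR₃ η₂ (g, 1) := rfl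

/-- (Ported verbatim from the HodgeCMPerL package; no docstring in the source.) -/
@[simp] theorem cWTwoG_apply (u : UfTwo c.D) :
    cWTwoG V c hGR hGR₂ hGR₃ η₂ u = finCharTwo V c.D hGR hGR₂ hGR₃ η₂ (1, u) := rfl

/-- **the untwisted dictionary-side character `ψ₂(η₂, χ) := chiTwoG χ · c_{W,2}(η₂)⁻¹`**. -/
def psiTwoG (χ : PontryaginDual (↥(relNormOneIdeles (↥(maximalRealSubfield L)) L) ⧸ relNormOneRat (↥(maximalRealSubfield L)) L)) :
    UfTwo c.D →* ℂˣ :=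
  chiTwoG c χ * (cWTwoG V c hGR hGR₂ hGR₃ η₂)⁻¹

/-- (Ported verbatim from the HodgeCMPerL package; no docstring in the source.) -/
theorem chiTwoG_eq_mul_psiTwoG
    (χ : PontryaginDual (↥(relNormOneIdeles (↥(maximalRealSubfield L)) L) ⧸ relNormOneRat (↥(maximalRealSubfield L)) L))
    (u : UfTwo c.D) :
    chiTwoG c χ u = finCharTwo V c.D hGR hGR₂ hGR₃ η₂ (1, u) * psiTwoG V c hGR hGR₂ hGR₃ η₂ χ u := by
  rw [psiTwoG, MonoidHom.mul_apply, MonoidHom.inv_apply, cWTwoG_apply, mul_comm (chiTwoG c χ u), ← mul_assoc, mul_inv_cancel,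
    one_mul]

section Coinv

variable (Φarch : Module.Dual ℂ (Fin 2 → ℂ) →ₗ[ℂ] 𝓢((Fin 3 → mixedSpace (↥(maximalRealSubfield L))), ℂ))
  (harm : ∀ (u : ↥(stabilizer U21 x₀)) (ℓ : Module.Dual ℂ (Fin 2 → ℂ)),
    lineOmega_two V c.D hGR hGR₂ hGR₃ η₂ (u : U21) (Φarch ℓ) =
      Φarch ((BallForms.isPullbackCocycle_cotangentCocycle.weightOf x₀).dual u ℓ))
  (hdef : ∀ a : UnitaryGroup.arch (↥(maximalRealSubfield L)) L (IsCMField.complexConj L) 3 V.Hm,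
    UnitaryGroup.archAt (↥(maximalRealSubfield L)) L (IsCMField.complexConj L) 3 V.Hm (UnitaryGroup.cmPlace (L : Type) ι₁)
        (NumberField.complexConj_smul_infinitePlace (L : Type) _) (IsCMField.complexConj_ne_one (L : Type)) a = 1 →
    ∀ (ℓ : Module.Dual ℂ (Fin 2 → ℂ)) (Φf : FinSB (↥(maximalRealSubfield L)) (Fin 3)),
      lineRepOf V c.D hGR hGR₀ hGR₁ hGR₂ hGR₃ η₀ η₁ η₂ η₃ 2
          (HodgeCM.Adelic.regimeEquiv L V.Hm hV
            (UnitaryGroup.archToAdelic (↥(maximalRealSubfield L)) L (IsCMField.complexConj L) 3 V.Hm a), 1)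
          (piSchwartzBruhatEquiv (↥(maximalRealSubfield L)) (Fin 3) (Φarch ℓ ⊗ₜ[ℂ] Φf)) =
        piSchwartzBruhatEquiv (↥(maximalRealSubfield L)) (Fin 3) (Φarch ℓ ⊗ₜ[ℂ] Φf))
  (χ : PontryaginDual (↥(relNormOneIdeles (↥(maximalRealSubfield L)) L) ⧸ relNormOneRat (↥(maximalRealSubfield L)) L))
  (ψ : UfTwo c.D →* ℂˣ)
  (hψ : ∀ u : UfTwo c.D, chiTwoG c χ u = finCharTwo V c.D hGR hGR₂ hGR₃ η₂ (1, u) * ψ u)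

local notation "D₂" => thetaDistDatumTwoOfG V c S hGR hGR₀ hGR₁ hGR₂ hGR₃ η₀ η₁ η₂ η₃ hι h₁W hV hω hη₂c Φarch harm hdef

/-- (T-W) `ω_{f,W}(u) (R f) = finCharTwo η₂ (1, u) • R (finPairRepW splitLineTwoG.hs u f)` for the G-datum. -/
theorem ωfW_twoG_finSBReindex (u : UfTwo c.D) (f : FinSB (↥(maximalRealSubfield L)) (Fin 3 × Fin 1)) :
    (D₂).ωfW u (finSBReindex (↥(maximalRealSubfield L)) e₁ f) =
      ((finCharTwo V c.D hGR hGR₂ hGR₃ η₂ (1, u) : ℂˣ) : ℂ) •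
        finSBReindex (↥(maximalRealSubfield L)) e₁
          (HodgeCM.WeilCoinv.finPairRepW _ _ _ _ _ _ _ _ _ _ _ _ _ _ _ _ _ (splitLineTwoG V c hGR₂).hs u f) := by
  show finRepTwo V c.D hGR hGR₂ hGR₃ η₂ (1, u) _ = _
  rw [finRepTwo_apply, map_one, LinearEquiv.symm_apply_apply]
  rfl

/-- (T-V) `ω_{f,V}(g) (R f) = finCharTwo η₂ (g, 1) • R (finPairRepV splitLineTwoG.hs (finFrameCongr g) f)` for the G-datum. -/
theorem ωfV_twoG_finSBReindex (g : ↥V.adelicFin) (f : FinSB (↥(maximalRealSubfield L)) (Fin 3 × Fin 1)) :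
    (D₂).ωfV g (finSBReindex (↥(maximalRealSubfield L)) e₁ f) =
      ((finCharTwo V c.D hGR hGR₂ hGR₃ η₂ (g, 1) : ℂˣ) : ℂ) •
        finSBReindex (↥(maximalRealSubfield L)) e₁
          (HodgeCM.WeilCoinv.finPairRepV _ _ _ _ _ _ _ _ _ _ _ _ _ _ _ _ _ (splitLineTwoG V c hGR₂).hs
            (finFrameCongr (L : Type) V.Hm (frameG V) (frameD V) (frame_congr V) g) f) := by
  show finRepTwo V c.D hGR hGR₂ hGR₃ η₂ (g, 1) _ = _
  rw [finRepTwo_apply, LinearEquiv.symm_apply_apply]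
  rfl

/-- **THE COINVARIANT COMPARISON OF SLOT 2 (G-datum)**: `Coinv (finPairRepW splitLineTwoG.hs) ψ ≃ₗ[ℂ] Coinv ω_{f,W} (chiFin χ)` whenever
`chiTwoG χ = finCharTwo η₂ (1, ·) · ψ`. -/
def coinvEquivTwoG :
    TwistedCoinv.Coinv (HodgeCM.WeilCoinv.finPairRepW _ _ _ _ _ _ _ _ _ _ _ _ _ _ _ _ _ (splitLineTwoG V c hGR₂).hs) ψ ≃ₗ[ℂ]
      TwistedCoinv.Coinv (D₂).ωfW ((D₂).chiFin χ) :=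
  TwistedCoinv.mapEquiv _ ψ _ _ (finSBReindex (↥(maximalRealSubfield L)) e₁) (fun u => finCharTwo V c.D hGR hGR₂ hGR₃ η₂ (1, u))
    (fun u f => ωfW_twoG_finSBReindex V c S hGR hGR₀ hGR₁ hGR₂ hGR₃ η₀ η₁ η₂ η₃ hι h₁W hV hω hη₂c Φarch harm hdef u f) hψ

/-- (Ported verbatim from the HodgeCMPerL package; no docstring in the source.) -/
@[simp] theorem coinvEquivTwoG_mk (f : FinSB (↥(maximalRealSubfield L)) (Fin 3 × Fin 1)) :
    coinvEquivTwoG V c S hGR hGR₀ hGR₁ hGR₂ hGR₃ η₀ η₁ η₂ η₃ hι h₁W hV hω hη₂c Φarch harm hdef χ ψ hψ (TwistedCoinv.mk _ ψ f) =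
      TwistedCoinv.mk _ _ (finSBReindex (↥(maximalRealSubfield L)) e₁ f) := rfl

/-- **THE INTERTWINING LAW (G-datum)**: `Ω₂(χ)(g) (E x) = finCharTwo η₂ (g, 1) • E (Ω(splitLineTwoG, ψ)(finFrameCongr g) x)`. -/
theorem coinvRep_coinvEquivTwoG (g : ↥V.adelicFin)
    (x : TwistedCoinv.Coinv (HodgeCM.WeilCoinv.finPairRepW _ _ _ _ _ _ _ _ _ _ _ _ _ _ _ _ _ (splitLineTwoG V c hGR₂).hs) ψ) :
    (D₂).coinvRep χ g (coinvEquivTwoG V c S hGR hGR₀ hGR₁ hGR₂ hGR₃ η₀ η₁ η₂ η₃ hι h₁W hV hω hη₂c Φarch harm hdef χ ψ hψ x) =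
      ((finCharTwo V c.D hGR hGR₂ hGR₃ η₂ (g, 1) : ℂˣ) : ℂ) •
        coinvEquivTwoG V c S hGR hGR₀ hGR₁ hGR₂ hGR₃ η₀ η₁ η₂ η₃ hι h₁W hV hω hη₂c Φarch harm hdef χ ψ hψ
          (HodgeCM.WeilCoinv.weilCoinv _ _ _ _ _ _ _ _ _ _ _ _ _ _ _ _ _ ψ (splitLineTwoG V c hGR₂).hs
            (finFrameCongr (L : Type) V.Hm (frameG V) (frameD V) (frame_congr V) g) x) :=
  TwistedCoinv.mapEquiv_rep _ ψ _ _
    (HodgeCM.WeilCoinv.finPairRepV _ _ _ _ _ _ _ _ _ _ _ _ _ _ _ _ _ (splitLineTwoG V c hGR₂).hs) _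
    (HodgeCM.WeilCoinv.commute_finPairRepV_finPairRepW _ _ _ _ _ _ _ _ _ _ _ _ _ _ _ _ _ (splitLineTwoG V c hGR₂).hs)
    (D₂).commute_ωfV_ωfW _ _ _ hψ
    (fun f => ωfV_twoG_finSBReindex V c S hGR hGR₀ hGR₁ hGR₂ hGR₃ η₀ η₁ η₂ η₃ hι h₁W hV hω hη₂c Φarch harm hdef g f) x

/-- the same law against the `c_{V,2}(η₂)`-twisted pullback. -/
theorem coinvEquivTwoG_twist_of_eq (cV : ↥V.adelicFin →* ℂˣ) (hcV : cV = cVTwoG V c hGR hGR₂ hGR₃ η₂) (g : ↥V.adelicFin)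
    (x : TwistedCoinv.Coinv (HodgeCM.WeilCoinv.finPairRepW _ _ _ _ _ _ _ _ _ _ _ _ _ _ _ _ _ (splitLineTwoG V c hGR₂).hs) ψ) :
    coinvEquivTwoG V c S hGR hGR₀ hGR₁ hGR₂ hGR₃ η₀ η₁ η₂ η₃ hι h₁W hV hω hη₂c Φarch harm hdef χ ψ hψ
        (SeesawScalar.twist cV
          ((HodgeCM.WeilCoinv.weilCoinv _ _ _ _ _ _ _ _ _ _ _ _ _ _ _ _ _ ψ (splitLineTwoG V c hGR₂).hs).comp
            (finFrameCongr (L : Type) V.Hm (frameG V) (frameD V) (frame_congr V))) g x) =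
      (D₂).coinvRep χ g (coinvEquivTwoG V c S hGR hGR₀ hGR₁ hGR₂ hGR₃ η₀ η₁ η₂ η₃ hι h₁W hV hω hη₂c Φarch harm hdef χ ψ hψ x) := by
  subst hcV
  rw [SeesawScalar.twist_apply, coinvRep_coinvEquivTwoG]
  exact map_smul (coinvEquivTwoG V c S hGR hGR₀ hGR₁ hGR₂ hGR₃ η₀ η₁ η₂ η₃ hι h₁W hV hω hη₂c Φarch harm hdef χ ψ hψ) _ _

include hψ in
/-- **THE BRIDGE OF SLOT 2 (G-datum), module currency**: `(twist c_{V,2}(η₂) (Ω(splitLineTwoG, ψ) ∘ finFrameCongr)).asModule ≃ₗ[ℂ[U(V)(𝔸_f)]]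
Ω₂(χ)`. -/
def ΩEquivTwoG :
    (SeesawScalar.twist (cVTwoG V c hGR hGR₂ hGR₃ η₂)
          ((HodgeCM.WeilCoinv.weilCoinv _ _ _ _ _ _ _ _ _ _ _ _ _ _ _ _ _ ψ (splitLineTwoG V c hGR₂).hs).comp
            (finFrameCongr (L : Type) V.Hm (frameG V) (frameD V) (frame_congr V)))).asModule ≃ₗ[adelicAlgebra V]
      ((D₂).coinvRep χ).asModule :=
  EquivariantLift.liftEquiv _ _ (coinvEquivTwoG V c S hGR hGR₀ hGR₁ hGR₂ hGR₃ η₀ η₁ η₂ η₃ hι h₁W hV hω hη₂c Φarch harm hdef χ ψ hψ)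
    (coinvEquivTwoG_twist_of_eq V c S hGR hGR₀ hGR₁ hGR₂ hGR₃ η₀ η₁ η₂ η₃ hι h₁W hV hω hη₂c Φarch harm hdef χ ψ hψ _ rfl)

include hψ in
/-- **BLOCKS EQUAL (slot 2, G-datum)**. -/
theorem iSup_range_coinvRep_twoG_eq {T : Type*} [AddCommMonoid T] [Module ℂ T] [Module (adelicAlgebra V) T]
    [IsScalarTower ℂ (adelicAlgebra V) T] :
    (⨆ f : ((D₂).coinvRep χ).asModule →ₗ[adelicAlgebra V] T, (LinearMap.range f).restrictScalars ℂ) =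
      ⨆ f : (SeesawScalar.twist (cVTwoG V c hGR hGR₂ hGR₃ η₂)
          ((HodgeCM.WeilCoinv.weilCoinv _ _ _ _ _ _ _ _ _ _ _ _ _ _ _ _ _ ψ (splitLineTwoG V c hGR₂).hs).comp
            (finFrameCongr (L : Type) V.Hm (frameG V) (frameD V) (frame_congr V)))).asModule →ₗ[adelicAlgebra V] T,
        (LinearMap.range f).restrictScalars ℂ :=
  (EquivariantLift.iSup_range_eq_of_equiv
    (ΩEquivTwoG V c S hGR hGR₀ hGR₁ hGR₂ hGR₃ η₀ η₁ η₂ η₃ hι h₁W hV hω hη₂c Φarch harm hdef χ ψ hψ)).symm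

/-! ## § 2. The twisted record of slot 2 (for a generic `η₂` the `V`-part `c_{V,2}(η₂) = η₂(·, 1)` need not be trivial) -/

variable (ĉ : (splitLineTwoG V c hGR₂).BigChar) (hĉ : (splitLineTwoG V c hGR₂).IsRatTrivial ĉ)
  (hĉV : (HodgeCM.WeilCoinv.twistCharV (↥(maximalRealSubfield L)) (L : Type) (IsCMField.complexConj L) 3 1
      (Matrix.diagonal (frameD V)) (splitLineTwoG V c hGR₂).JW ĉ).comp
        (finFrameCongr (L : Type) V.Hm (frameG V) (frameD V) (frame_congr V)) = cVTwoG V c hGR hGR₂ hGR₃ η₂)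
  (χ'' : (splitLineTwoG V c hGR₂).CharW)
  (hχ'' : ∀ u, χ'' u =
    HodgeCM.WeilCoinv.twistCharW (↥(maximalRealSubfield L)) (L : Type) (IsCMField.complexConj L) 3 1
      (Matrix.diagonal (frameD V)) (splitLineTwoG V c hGR₂).JW ĉ u * ψ u)

include hψ hĉV in
/-- **SLOT 2 LANDS IN THE DICTIONARY THROUGH A TWISTED RECORD**: for a rationally trivial big character `ĉ` of `splitLineTwoG` with `V`-part
`c_{V,2}(η₂)` along `finFrameCongr` and `χ″ = twistCharW ĉ · ψ`, `Ω(splitLineTwoG ⊗ ĉ, χ″) ≃ₗ[ℂ[U(V)(𝔸_f)]] Ω₂(χ)`. -/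
def dictEquivTwoOfBigCharG :
    ((splitLineTwoG V c hGR₂).twistBy ĉ hĉ).Ω (finFrameCongr (L : Type) V.Hm (frameG V) (frameD V) (frame_congr V)) χ''
      ≃ₗ[adelicAlgebra V] ((D₂).coinvRep χ).asModule :=
  ((splitLineTwoG V c hGR₂).ΩTwistByEquiv (finFrameCongr (L : Type) V.Hm (frameG V) (frameD V) (frame_congr V)) ĉ hĉ hχ'').trans
    (EquivariantLift.liftEquiv _ _ (coinvEquivTwoG V c S hGR hGR₀ hGR₁ hGR₂ hGR₃ η₀ η₁ η₂ η₃ hι h₁W hV hω hη₂c Φarch harm hdef χ ψ hψ)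
      (coinvEquivTwoG_twist_of_eq V c S hGR hGR₀ hGR₁ hGR₂ hGR₃ η₀ η₁ η₂ η₃ hι h₁W hV hω hη₂c Φarch harm hdef χ ψ hψ _ hĉV))

end Coinv

/-! ### § 2a. The big character of slot 2 -/

/-- **the adelic `V`-character of slot 2**: `v ↦ η₂(v, 1) · χ₂(v, 1)` on `U(diag frameD V)(𝔸)` (`χ₂(v,1) = λ₄(1) = 1`, kept for symmetry). -/
def adelicCharTwoG : CMAdelic (L : Type) (frameD V) →* ℂˣ :=
  η₂.comp (MonoidHom.inl _ _) *
    (cmConjLineChar₀ (L : Type) finProdFinEquiv e₁ (frameD V) (frameD_real V) (frameD_ne V) (dW c.D) (dW_real c.D) (dW_ne c.D)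
        (dW' c.D) (dW'_real c.D) (dW'_ne c.D) c.D.isoGL (isoGL_hg₀ c.D) hGR hGR₂ hGR₃).comp (MonoidHom.inl _ _)

/-- (Ported verbatim from the HodgeCMPerL package; no docstring in the source.) -/
@[simp] theorem adelicCharTwoG_apply (v : CMAdelic (L : Type) (frameD V)) :
    adelicCharTwoG V c hGR hGR₂ hGR₃ η₂ v =
      η₂ (v, 1) *
        cmConjLineChar₀ (L : Type) finProdFinEquiv e₁ (frameD V) (frameD_real V) (frameD_ne V) (dW c.D) (dW_real c.D) (dW_ne c.D)
        (dW' c.D) (dW'_real c.D) (dW'_ne c.D) c.D.isoGL (isoGL_hg₀ c.D) hGR hGR₂ hGR₃ (v, 1) := rfl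


/-- the line `⟨a₂⟩` has a nonzero Gram entry. -/
theorem lineVec_dW'_zero_ne : (Matrix.diagonal (lineVec (L : Type) (dW' c.D 0))) default default ≠ 0 := by
  rw [Fin.default_eq_zero, Matrix.diagonal_apply_eq]
  exact dW'_ne c.D 0

/-- **THE BIG CHARACTER OF SLOT 2**: `ĉ₂(η₂) := adelicCharTwoG η₂ ∘ (G₁(𝔸) ≃ U(diag frameD V)(𝔸))` (#1255 `LinePair.bigCharOfV`). -/
def bigCharTwoG : (splitLineTwoG V c hGR₂).BigChar :=
  LinePair.bigCharOfV (↥(maximalRealSubfield L)) (L : Type) (IsCMField.complexConj L) 3 (Matrix.diagonal (frameD V))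
    (Matrix.diagonal (lineVec (L : Type) (dW' c.D 0))) (lineVec_dW'_zero_ne c) (adelicCharTwoG V c hGR hGR₂ hGR₃ η₂)

/-- **its `V`-part along `finFrameCongr` is `c_{V,2}(η₂)`**. -/
theorem twistCharV_bigCharTwoG_comp :
    (HodgeCM.WeilCoinv.twistCharV (↥(maximalRealSubfield L)) (L : Type) (IsCMField.complexConj L) 3 1
          (Matrix.diagonal (frameD V)) (splitLineTwoG V c hGR₂).JW (bigCharTwoG V c hGR hGR₂ hGR₃ η₂)).comp
        (finFrameCongr (L : Type) V.Hm (frameG V) (frameD V) (frame_congr V)) =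
      cVTwoG V c hGR hGR₂ hGR₃ η₂ := by
  ext g : 1
  rw [MonoidHom.comp_apply, cVTwoG_apply, finCharTwo_apply, finPairDTwo_apply, map_one, map_one]
  show (HodgeCM.WeilCoinv.twistCharV (↥(maximalRealSubfield L)) (L : Type) (IsCMField.complexConj L) 3 1
      (Matrix.diagonal (frameD V)) (Matrix.diagonal (lineVec (L : Type) (dW' c.D 0))) (bigCharTwoG V c hGR hGR₂ hGR₃ η₂)) _ = _
  rw [bigCharTwoG, LinePair.twistCharV_bigCharOfV, MonoidHom.comp_apply, adelicCharTwoG_apply]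
  rfl

/-! ### § 2b. Rational triviality of `ĉ₂(η₂)` -/

/-- `χ₂(v, 1) = λ_V′(v) = 1` on rational `v` ([Weil1964, Thm 6] `charV₃₄_eq_one_of_rational` at the rational conjugator `ratIsometry_conj`). -/
theorem cmConjLineChar₀_inl_eq_one_of_rat {v : CMAdelic (L : Type) (frameD V)} (hv : v ∈ CMRat (L : Type) (frameD V)) :
    cmConjLineChar₀ (L : Type) finProdFinEquiv e₁ (frameD V) (frameD_real V) (frameD_ne V) (dW c.D) (dW_real c.D) (dW_ne c.D)
        (dW' c.D) (dW'_real c.D) (dW'_ne c.D) c.D.isoGL (isoGL_hg₀ c.D) hGR hGR₂ hGR₃ (v, 1) = 1 := by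
  rw [cmConjLineChar₀]
  simp only [MonoidHom.mul_apply, MonoidHom.coe_comp, Function.comp_apply, MonoidHom.coe_fst, MonoidHom.coe_snd, map_one,
    mul_one]
  apply charV₃₄_eq_one_of_rational
  · exact ratIsometry_conj (L : Type) (dW c.D) (dW' c.D) c.D.isoGL (isoGL_hg₀ c.D)
  · exact hv

variable (hη₂V : ∀ v ∈ CMRat (L : Type) (frameD V), η₂ (v, 1) = 1)

include hη₂V in
/-- **`adelicCharTwoG η₂ = 1` on `U(diag frameD V)(L⁺)`** under the ONE hypothesis `hη₂V` (the slot character's `V`-part is automorphic). -/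
theorem adelicCharTwoG_eq_one_of_rat {v : CMAdelic (L : Type) (frameD V)} (hv : v ∈ CMRat (L : Type) (frameD V)) :
    adelicCharTwoG V c hGR hGR₂ hGR₃ η₂ v = 1 := by
  rw [adelicCharTwoG_apply, cmConjLineChar₀_inl_eq_one_of_rat V c hGR hGR₂ hGR₃ hv, mul_one, hη₂V v hv]

include hη₂V in
/-- **`ĉ₂(η₂)` IS RATIONALLY TRIVIAL**. -/
theorem bigCharTwoG_isRatTrivial : (splitLineTwoG V c hGR₂).IsRatTrivial (bigCharTwoG V c hGR hGR₂ hGR₃ η₂) := fun γ₀ =>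
  LinePair.bigCharOfV_rationalPairToAdelic' _ _ _ _ _ _ _ _ (fun _ hv => adelicCharTwoG_eq_one_of_rat V c hGR hGR₂ hGR₃ η₂ hη₂V hv) γ₀

/-- **THE TWISTED INDEX RECORD OF SLOT 2**: `splitLineTwoG ⊗ ĉ₂(η₂)`. -/
def splitLineTwoTwistedG :
    SplitLine (Matrix.diagonal (frameD V)) (realDiagonal (L : Type) (frameD V) (frameD_real V))
      (complexConj_imagUnit (L : Type)) (imagUnit_ne_zero (L : Type)) (imagUnit_mul_self (L : Type))
      (realDiagonal_isSymm (L : Type) (frameD V) (frameD_real V))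
      (isUnit_det_realDiagonal (L : Type) (frameD V) (frameD_real V) (frameD_ne V))
      (realDiagonal_map (L : Type) (frameD V) (frameD_real V)).symm :=
  (splitLineTwoG V c hGR₂).twistBy (bigCharTwoG V c hGR hGR₂ hGR₃ η₂) (bigCharTwoG_isRatTrivial V c hGR hGR₂ hGR₃ η₂ hη₂V)

/-- **the canonical dictionary character of slot 2 at `(η₂, χ)`**: `χ″₂ := twistCharW ĉ₂(η₂) · ψ₂(η₂, χ)`. -/
def charTwoDictG (χ : PontryaginDual (↥(relNormOneIdeles (↥(maximalRealSubfield L)) L) ⧸ relNormOneRat (↥(maximalRealSubfield L)) L)) :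
    (splitLineTwoG V c hGR₂).CharW :=
  HodgeCM.WeilCoinv.twistCharW (↥(maximalRealSubfield L)) (L : Type) (IsCMField.complexConj L) 3 1
      (Matrix.diagonal (frameD V)) (splitLineTwoG V c hGR₂).JW (bigCharTwoG V c hGR hGR₂ hGR₃ η₂) *
    (show (splitLineTwoG V c hGR₂).CharW from psiTwoG V c hGR hGR₂ hGR₃ η₂ χ)

section Canonical

variable (Φarch : Module.Dual ℂ (Fin 2 → ℂ) →ₗ[ℂ] 𝓢((Fin 3 → mixedSpace (↥(maximalRealSubfield L))), ℂ))
  (harm : ∀ (u : ↥(stabilizer U21 x₀)) (ℓ : Module.Dual ℂ (Fin 2 → ℂ)),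
    lineOmega_two V c.D hGR hGR₂ hGR₃ η₂ (u : U21) (Φarch ℓ) =
      Φarch ((BallForms.isPullbackCocycle_cotangentCocycle.weightOf x₀).dual u ℓ))
  (hdef : ∀ a : UnitaryGroup.arch (↥(maximalRealSubfield L)) L (IsCMField.complexConj L) 3 V.Hm,
    UnitaryGroup.archAt (↥(maximalRealSubfield L)) L (IsCMField.complexConj L) 3 V.Hm (UnitaryGroup.cmPlace (L : Type) ι₁)
        (NumberField.complexConj_smul_infinitePlace (L : Type) _) (IsCMField.complexConj_ne_one (L : Type)) a = 1 →
    ∀ (ℓ : Module.Dual ℂ (Fin 2 → ℂ)) (Φf : FinSB (↥(maximalRealSubfield L)) (Fin 3)),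
      lineRepOf V c.D hGR hGR₀ hGR₁ hGR₂ hGR₃ η₀ η₁ η₂ η₃ 2
          (HodgeCM.Adelic.regimeEquiv L V.Hm hV
            (UnitaryGroup.archToAdelic (↥(maximalRealSubfield L)) L (IsCMField.complexConj L) 3 V.Hm a), 1)
          (piSchwartzBruhatEquiv (↥(maximalRealSubfield L)) (Fin 3) (Φarch ℓ ⊗ₜ[ℂ] Φf)) =
        piSchwartzBruhatEquiv (↥(maximalRealSubfield L)) (Fin 3) (Φarch ℓ ⊗ₜ[ℂ] Φf))
  (χ : PontryaginDual (↥(relNormOneIdeles (↥(maximalRealSubfield L)) L) ⧸ relNormOneRat (↥(maximalRealSubfield L)) L))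

local notation "D₂" => thetaDistDatumTwoOfG V c S hGR hGR₀ hGR₁ hGR₂ hGR₃ η₀ η₁ η₂ η₃ hι h₁W hV hω hη₂c Φarch harm hdef

/-- **SLOT 2, CANONICAL FORM (G-datum)**: `Ω(splitLineTwoG ⊗ ĉ₂(η₂), χ″₂) ≃ₗ[ℂ[U(V)(𝔸_f)]] Ω₂(χ)` — the index pair
`(splitLineTwoTwistedG, charTwoDictG χ)` of axioms-1's dictionary at `ιVE V = finFrameCongr` carries EXACTLY the honest slot-2 module of the
G-datum, at every pin. -/
def dictEquivTwoCanonicalG :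
    (splitLineTwoTwistedG V c hGR hGR₂ hGR₃ η₂ hη₂V).Ω (finFrameCongr (L : Type) V.Hm (frameG V) (frameD V) (frame_congr V))
        (charTwoDictG V c hGR hGR₂ hGR₃ η₂ χ) ≃ₗ[adelicAlgebra V] ((D₂).coinvRep χ).asModule :=
  dictEquivTwoOfBigCharG V c S hGR hGR₀ hGR₁ hGR₂ hGR₃ η₀ η₁ η₂ η₃ hι h₁W hV hω hη₂c Φarch harm hdef χ
    (psiTwoG V c hGR hGR₂ hGR₃ η₂ χ) (chiTwoG_eq_mul_psiTwoG V c hGR hGR₂ hGR₃ η₂ χ) _ _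
    (twistCharV_bigCharTwoG_comp V c hGR hGR₂ hGR₃ η₂) (charTwoDictG V c hGR hGR₂ hGR₃ η₂ χ) fun _ => rfl

/-- hence the `adelicAlgebra V`-linear SURJECTION binder-2's block socket (#101 ∕ #102) consumes, slot 2, any pin. -/
theorem dictEquivTwoCanonicalG_surjective :
    Function.Surjective (dictEquivTwoCanonicalG V c S hGR hGR₀ hGR₁ hGR₂ hGR₃ η₀ η₁ η₂ η₃ hι h₁W hV hω hη₂c hη₂V Φarch harm hdef χ) :=
  (dictEquivTwoCanonicalG V c S hGR hGR₀ hGR₁ hGR₂ hGR₃ η₀ η₁ η₂ η₃ hι h₁W hV hω hη₂c hη₂V Φarch harm hdef χ).surjective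

/-- **BLOCKS EQUAL (slot 2, dictionary currency, G-datum)**. -/
theorem iSup_range_coinvRep_twoG_eq_dict {T : Type*} [AddCommMonoid T] [Module ℂ T] [Module (adelicAlgebra V) T]
    [IsScalarTower ℂ (adelicAlgebra V) T] :
    (⨆ f : ((D₂).coinvRep χ).asModule →ₗ[adelicAlgebra V] T, (LinearMap.range f).restrictScalars ℂ) =
      ⨆ f : (splitLineTwoTwistedG V c hGR hGR₂ hGR₃ η₂ hη₂V).Ω (finFrameCongr (L : Type) V.Hm (frameG V) (frameD V) (frame_congr V))
          (charTwoDictG V c hGR hGR₂ hGR₃ η₂ χ) →ₗ[adelicAlgebra V] T, (LinearMap.range f).restrictScalars ℂ :=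
  (EquivariantLift.iSup_range_eq_of_equiv
    (dictEquivTwoCanonicalG V c S hGR hGR₀ hGR₁ hGR₂ hGR₃ η₀ η₁ η₂ η₃ hι h₁W hV hω hη₂c hη₂V Φarch harm hdef χ)).symm

end Canonical

end ThetaAdelicSide
end HodgeCM.Model

end
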